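import Mathlib.FieldTheory.Finite.Basic
import Mathlib.FieldTheory.Perfect
import Mathlib.FieldTheory.IsAlgClosed.AlgebraicClosure
import Literature.NumberTheory.DiophantineGeometry.PlaneCurvePointCountFinalProofs
import Literature.NumberTheory.DiophantineGeometry.PlaneCurveBezoutWeak
import HarnessLib

/-!
# Plane curves with a non-singular rational point over a finite field: absolute irreducibility and many points

Two classical consequences of Weil's theorem for plane curves over `K = 𝔽_q`, in the coordinates
of `PlaneCurvePointCountFinalProofs` (`P ∈ K[X][Y]`, zeros counted in `K × K`):

* `irreducible_map_of_nonsingular` — **descent**: an irreducible `u ∈ K[X][Y]` with a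
  `K`-rational zero `(a, b)` at which `∂u/∂Y ≠ 0` is absolutely irreducible (irreducible in
  `L[X][Y]` for every embedding `σ : K → L` into an algebraically closed field).  Proof by
  Frobenius descent: the irreducible factor of `u` over `L` through `(σ a, σ b)` is unique and
  simple, hence fixed by the `q`-Frobenius acting on coefficients once one coefficient is
  normalised to `1`; so it and its cofactor have coefficients in `σ(K)` (the fixed points of
  `c ↦ c^q`, `pow_card_eq_self_iff`) and the factorisation descends to `K[X][Y]`.
* `exists_le_ncard_zeros_of_nonsingular` — **uniformly many points**: for all `N, n` there is
  `q₀(N, n)` such that over every finite field with `q ≥ q₀` elements, for all `F, Q ∈ K[X][Y]`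
  of `Y`-degree `≤ N` with coefficients of `X`-degree `≤ N`, a point `(a, b)` with `F(a,b) = 0`,
  `∂_Y F(a,b) ≠ 0`, `Q(a,b) ≠ 0` forces at least `n` points of `{F = 0, Q ≠ 0}`: Weil's lower
  bound for the absolutely irreducible factor through `(a, b)`
  (`abs_card_zeros_sub_le_of_irreducible_map`) minus the weak Bézout bound for its common zeros
  with `Q` (`Dioph.commonZeros_finite_ncard_le`).

These are the finite-field inputs of the transfer argument showing that pseudo-finite fields are
PAC for plane curves (`Literature/ModelTheory/PseudofiniteFields/PlaneCurvesPseudofinite.lean`).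
No definitions, no named facts.

## References

* A. Weil, *Sur les courbes algébriques et les variétés qui s'en déduisent*, Hermann 1948.
  [Weil1948]
* A. Cafure, G. Matera, *Improved explicit estimates on the number of solutions of equations over
  a finite field*, Finite Fields Appl. 12 (2006) 155–185, Lemma 5.1. [CafureMatera2006]
-/

noncomputable section

open scoped Classical Polynomial.Bivariate
open Polynomial

namespace Literature.NumberTheory.DiophantineGeometry.PlaneShear

universe u v

section Frobenius

variable {K : Type u} [Field K] [Fintype K] {L : Type v} [Field L] [IsAlgClosed L] (σ : K →+* L)

omit [IsAlgClosed L] in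
/-- The elements of a field `L ⊇ 𝔽_q` fixed by `c ↦ c^q` are exactly the elements of `𝔽_q`:
both sets consist of roots of `T^q - T`, which has at most `q` of them. [folklore] -/
theorem pow_card_eq_self_iff (c : L) : c ^ Fintype.card K = c ↔ c ∈ Set.range σ := by
  set q := Fintype.card K with hq
  have hq1 : 1 < q := Fintype.one_lt_card
  constructor
  · intro hc
    by_contra hnot
    set T : L[X] := X ^ q - X with hT
    have hT0 : T ≠ 0 := FiniteField.X_pow_card_sub_X_ne_zero L hq1
    have hroot : ∀ x, x ^ q = x → x ∈ T.roots.toFinset := fun x hx => by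
      rw [Multiset.mem_toFinset, mem_roots hT0, IsRoot, eval_sub, eval_pow, eval_X, hx, sub_self]
    have hsub : insert c (Finset.univ.image σ) ⊆ T.roots.toFinset := by
      intro x hx
      rcases Finset.mem_insert.1 hx with rfl | hx
      · exact hroot x hc
      · obtain ⟨y, -, rfl⟩ := Finset.mem_image.1 hx
        exact hroot _ (by rw [← map_pow, FiniteField.pow_card])
    have hcard := Finset.card_le_card hsub
    rw [Finset.card_insert_of_notMem (fun h => hnot (by
        obtain ⟨y, -, rfl⟩ := Finset.mem_image.1 h; exact ⟨y, rfl⟩)),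
      Finset.card_image_of_injective _ σ.injective, Finset.card_univ] at hcard
    have hle : T.roots.toFinset.card ≤ q :=
      (Multiset.toFinset_card_le _).trans
        ((card_roots' T).trans (FiniteField.X_pow_card_sub_X_natDegree_eq L hq1).le)
    omega
  · rintro ⟨y, rfl⟩
    rw [← map_pow, FiniteField.pow_card]

include σ in
/-- The `q`-power map of an algebraically closed field containing `𝔽_q` is a ring automorphism.
[folklore] -/
theorem exists_ringEquiv_pow_card : ∃ φ : L ≃+* L, ∀ x, φ x = x ^ Fintype.card K := by
  obtain ⟨p, hchar, n, hp, hq⟩ := FiniteField.card' K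
  haveI : Fact p.Prime := ⟨hp⟩
  haveI : CharP L p := (RingHom.charP_iff_charP σ p).1 hchar
  exact ⟨iterateFrobeniusEquiv L p n, fun x => by rw [iterateFrobeniusEquiv_def, hq]⟩

omit [IsAlgClosed L] in
/-- Two-variable Frobenius: coefficients of `Ψ(w) = map (map φ) w`. [folklore] -/
theorem coeff_coeff_map_map (φ : L →+* L) (w : L[X][Y]) (k j : ℕ) :
    ((w.map (mapRingHom φ)).coeff k).coeff j = φ ((w.coeff k).coeff j) := by
  rw [coeff_map, coe_mapRingHom, coeff_map]

omit [Fintype K] [IsAlgClosed L] in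
/-- A polynomial of `L[X][Y]` all of whose coefficients lie in `σ(K)` comes from `K[X][Y]`.
[folklore] -/
theorem exists_map_map_eq_of_coeff_mem_range {w : L[X][Y]}
    (h : ∀ k j, (w.coeff k).coeff j ∈ Set.range σ) :
    ∃ w₀ : K[X][Y], w₀.map (mapRingHom σ) = w := by
  rw [← mem_lifts, lifts_iff_coeff_lifts]
  intro k
  obtain ⟨c, hc⟩ := (mem_lifts _).1 ((lifts_iff_coeff_lifts _).2 (h k))
  exact ⟨c, hc⟩

omit [Fintype K] [IsAlgClosed L] in
/-- Only units of `K[X][Y]` become units of `L[X][Y]`. [folklore] -/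
theorem isUnit_of_isUnit_map {w₀ : K[X][Y]} (h : IsUnit (w₀.map (mapRingHom σ))) : IsUnit w₀ := by
  have hinj : Function.Injective (mapRingHom σ) := map_injective σ σ.injective
  obtain ⟨r, hr, hrw⟩ := Polynomial.isUnit_iff.1 h
  have hdeg : w₀.natDegree = 0 := by
    rw [← natDegree_map_eq_of_injective hinj, ← hrw, natDegree_C]
  obtain ⟨r₀, hr₀, hr₀r⟩ := Polynomial.isUnit_iff.1 hr
  have hdeg₀ : (w₀.coeff 0).natDegree = 0 := by
    have : (w₀.map (mapRingHom σ)).coeff 0 = r := by rw [← hrw, coeff_C_zero]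
    rw [coeff_map, coe_mapRingHom] at this
    rw [← natDegree_map_eq_of_injective σ.injective, this, ← hr₀r, natDegree_C]
  have hc0 : (w₀.coeff 0).coeff 0 ≠ 0 := by
    intro h0
    have : w₀ = 0 := by
      rw [eq_C_of_natDegree_eq_zero hdeg, eq_C_of_natDegree_eq_zero hdeg₀, h0, C_0, C_0]
    rw [this, Polynomial.map_zero] at h
    exact not_isUnit_zero h
  rw [eq_C_of_natDegree_eq_zero hdeg, eq_C_of_natDegree_eq_zero hdeg₀]
  exact (isUnit_C.2 (isUnit_C.2 (isUnit_iff_ne_zero.2 hc0)))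

omit [Fintype K] [IsAlgClosed L] in
/-- A unit of `L[X][Y]` is a non-zero constant: its coefficients. [folklore] -/
theorem coeff_coeff_C_C_mul (c : L) (w : L[X][Y]) (k j : ℕ) :
    ((C (C c) * w).coeff k).coeff j = c * (w.coeff k).coeff j := by
  rw [coeff_C_mul, coeff_C_mul]

/-- **Descent: an irreducible plane curve with a non-singular rational point is absolutely
irreducible.**  Let `K = 𝔽_q`, `σ : K → L` an embedding into an algebraically closed field, and
`u ∈ K[X][Y]` irreducible with a `K`-rational zero `(a, b)` at which `∂u/∂Y ≠ 0`.  Then `u` stays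
irreducible in `L[X][Y]`.  Proof: the irreducible factor `w` of `u` over `L` through `(σa, σb)`
is unique and simple (product rule), so the `q`-Frobenius `Ψ` (acting on coefficients) fixes it
up to a constant; normalising one coefficient of `w` to `1` the constant is `1`, so the
coefficients of `w` and of its cofactor satisfy `c^q = c`, i.e. lie in `σ(K)`; hence the
factorisation descends to `K[X][Y]`, where `u` is irreducible, forcing the cofactor to be a unit.
[folklore] -/
theorem irreducible_map_of_nonsingular {u : K[X][Y]} (hu : Irreducible u) {a b : K}
    (h0 : u.evalEval a b = 0) (h1 : (derivative u).evalEval a b ≠ 0) :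
    Irreducible (u.map (mapRingHom σ)) := by
  obtain ⟨φ, hφ⟩ := exists_ringEquiv_pow_card σ
  have hinj : Function.Injective (mapRingHom σ) := map_injective σ σ.injective
  have hinj₂ : Function.Injective (fun z : K[X][Y] => z.map (mapRingHom σ)) :=
    map_injective (mapRingHom σ) hinj
  set F : L[X][Y] := u.map (mapRingHom σ) with hF
  set a' : L := σ a with ha'
  set b' : L := σ b with hb'
  have hφσ : ∀ y : K, φ (σ y) = σ y := fun y => by rw [hφ, ← map_pow, FiniteField.pow_card]
  have hφσ' : (φ : L →+* L).comp σ = σ := RingHom.ext hφσ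
  -- the Frobenius on `L[X][Y]`
  let Ψ : L[X][Y] → L[X][Y] := fun w => w.map (mapRingHom (φ : L →+* L))
  have hΨe : ∀ w, (mapEquiv (mapEquiv φ)) w = Ψ w := fun w => by
    change w.map _ = w.map _
    congr 1
  have hΨirr : ∀ w, Irreducible w → Irreducible (Ψ w) := fun w hw => by
    rw [← hΨe]; exact (MulEquiv.irreducible_iff (mapEquiv (mapEquiv φ))).2 hw
  have hΨmul : ∀ w w', Ψ (w * w') = Ψ w * Ψ w' := fun w w' => Polynomial.map_mul _
  have hΨF : Ψ F = F := by
    change (u.map (mapRingHom σ)).map _ = _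
    rw [Polynomial.map_map, mapRingHom_comp, hφσ']
  have hΨcoeff : ∀ w k j, ((Ψ w).coeff k).coeff j = φ ((w.coeff k).coeff j) := fun w k j =>
    coeff_coeff_map_map (φ : L →+* L) w k j
  have hΨeval : ∀ w, (Ψ w).evalEval a' b' = φ (w.evalEval a' b') := fun w => by
    have := map_mapRingHom_evalEval (φ : L →+* L) w a' b'
    simp only [RingHom.coe_coe] at this
    rwa [ha', hb', hφσ, hφσ, ← ha', ← hb'] at this
  -- values at the point
  have hF0 : F ≠ 0 := fun h =>
    hu.ne_zero (hinj₂ (show u.map (mapRingHom σ) = (0 : K[X][Y]).map (mapRingHom σ) by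
      rw [Polynomial.map_zero]; exact h))
  have hFab : F.evalEval a' b' = 0 := by
    rw [hF, ha', hb', map_mapRingHom_evalEval, h0, map_zero]
  have hFd : (derivative F).evalEval a' b' ≠ 0 := by
    rw [hF, derivative_map, ha', hb', map_mapRingHom_evalEval]
    exact fun h => h1 (σ.injective (h.trans (map_zero σ).symm))
  -- an irreducible factor through the point, normalised
  obtain ⟨w, hwmem, hwab⟩ := (evalEval_eq_zero_iff_exists_normalizedFactor hF0 a' b').1 hFab
  have hwirr : Irreducible w := UniqueFactorizationMonoid.irreducible_of_normalized_factor w hwmem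
  have hwdvd : w ∣ F := UniqueFactorizationMonoid.dvd_of_mem_normalizedFactors hwmem
  have hw0 : w ≠ 0 := hwirr.ne_zero
  set k₀ := w.natDegree with hk₀
  set j₀ := (w.coeff k₀).natDegree with hj₀
  set e₀ : L := (w.coeff k₀).coeff j₀ with he₀
  have he₀0 : e₀ ≠ 0 := by
    rw [he₀, hj₀, Polynomial.coeff_natDegree, leadingCoeff_ne_zero, hk₀, Polynomial.coeff_natDegree]
    exact leadingCoeff_ne_zero.2 hw0
  set w₁ : L[X][Y] := C (C e₀⁻¹) * w with hw₁
  have hunit : IsUnit (C (C e₀⁻¹) : L[X][Y]) := isUnit_C.2 (isUnit_C.2 (isUnit_iff_ne_zero.2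
    (inv_ne_zero he₀0)))
  have hw₁irr : Irreducible w₁ := (irreducible_isUnit_mul hunit).2 hwirr
  have hw₁0 : w₁ ≠ 0 := hw₁irr.ne_zero
  have hw₁coeff : (w₁.coeff k₀).coeff j₀ = 1 := by
    rw [hw₁, coeff_coeff_C_C_mul, ← he₀, inv_mul_cancel₀ he₀0]
  have hw₁ab : w₁.evalEval a' b' = 0 := by
    rw [hw₁, evalEval_mul, hwab, mul_zero]
  obtain ⟨v, hv⟩ := hwdvd
  set v₁ : L[X][Y] := C (C e₀) * v with hv₁
  have hFwv : F = w₁ * v₁ := by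
    rw [hv, hw₁, hv₁, mul_mul_mul_comm, ← C_mul, ← C_mul, inv_mul_cancel₀ he₀0, C_1, C_1, one_mul]
  clear_value e₀ w₁ v₁
  -- the cofactor does not vanish at the point (product rule), so the factor through it is unique
  have hv₁ab : v₁.evalEval a' b' ≠ 0 := by
    intro hv0
    apply hFd
    rw [hFwv, derivative_mul, evalEval_add, evalEval_mul, evalEval_mul, hw₁ab, hv0, mul_zero,
      zero_mul, add_zero]
  have huniq : ∀ w', Irreducible w' → w' ∣ F → w'.evalEval a' b' = 0 → Associated w' w₁ := by
    intro w' hw' hdvd hab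
    have hprime : Prime w' := UniqueFactorizationMonoid.irreducible_iff_prime.1 hw'
    rw [hFwv] at hdvd
    rcases hprime.dvd_or_dvd hdvd with h | h
    · exact hw'.associated_of_dvd hw₁irr h
    · exfalso
      obtain ⟨v', hv'⟩ := h
      exact hv₁ab (by rw [hv', evalEval_mul, hab, zero_mul])
  -- Frobenius fixes `w₁`
  have hΨw₁ : Ψ w₁ = w₁ := by
    have hdvd : Ψ w₁ ∣ F := by
      rw [← hΨF, hFwv, hΨmul]; exact dvd_mul_right _ _
    have hab : (Ψ w₁).evalEval a' b' = 0 := by rw [hΨeval, hw₁ab, map_zero]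
    obtain ⟨e, he⟩ := huniq _ (hΨirr _ hw₁irr) hdvd hab
    obtain ⟨c, hc0, hce⟩ := exists_eq_C_C_of_isUnit e.isUnit
    -- compare the `(k₀, j₀)` coefficients: `φ 1 · c = 1`
    have hcoef : ((Ψ w₁ * ↑e).coeff k₀).coeff j₀ = (w₁.coeff k₀).coeff j₀ := by rw [he]
    rw [hce, mul_comm, coeff_coeff_C_C_mul, hΨcoeff, hw₁coeff, map_one, mul_one] at hcoef
    calc Ψ w₁ = Ψ w₁ * ↑e := by rw [hce, hcoef, C_1, C_1, mul_one]
      _ = w₁ := he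
  -- hence so is `v₁`
  have hΨv₁ : Ψ v₁ = v₁ := by
    have := hΨF
    rw [hFwv, hΨmul, hΨw₁] at this
    exact mul_left_cancel₀ hw₁0 this
  -- descend
  have hdesc : ∀ z : L[X][Y], Ψ z = z → ∃ z₀ : K[X][Y], z₀.map (mapRingHom σ) = z := fun z hz =>
    exists_map_map_eq_of_coeff_mem_range σ fun k j => (pow_card_eq_self_iff σ _).1 (by
      rw [← hφ, ← hΨcoeff, hz])
  obtain ⟨w₀, hw₀⟩ := hdesc w₁ hΨw₁
  obtain ⟨v₀, hv₀⟩ := hdesc v₁ hΨv₁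
  have huwv : u = w₀ * v₀ :=
    hinj₂ (show u.map (mapRingHom σ) = (w₀ * v₀).map (mapRingHom σ) by
      rw [Polynomial.map_mul, hw₀, hv₀, ← hFwv])
  rcases hu.isUnit_or_isUnit huwv with hw₀u | hv₀u
  · exact absurd ((hw₀ ▸ hw₀u.map (mapRingHom (mapRingHom σ))) : IsUnit w₁) hw₁irr.not_isUnit
  · have hv₁u : IsUnit v₁ := hv₀ ▸ hv₀u.map (mapRingHom (mapRingHom σ))
    rw [hFwv]
    exact (irreducible_mul_isUnit hv₁u).2 hw₁irr

end Frobenius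

section Count

variable {K : Type u} [Field K] [Fintype K]

omit [Fintype K] in
/-- Degree bookkeeping: if `deg_Y F ≤ N` and every coefficient has `deg_X ≤ N`, every divisor `u`
of `F ≠ 0` has no monomial `X^j Y^k` with `j + k > 2N`, and `deg_Y u ≤ N`,
`deg_X (coeff) ≤ 2N`. [folklore] -/
theorem degree_bounds_of_dvd {F u : K[X][Y]} (hF0 : F ≠ 0) (hu : u ∣ F) {N : ℕ}
    (hFd : F.natDegree ≤ N) (hFc : ∀ k, (F.coeff k).natDegree ≤ N) :
    (∀ k j, 2 * N < j + k → (u.coeff k).coeff j = 0) ∧ u.natDegree ≤ N ∧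
      ∀ k, (u.coeff k).natDegree ≤ 2 * N := by
  have hsupF : (F.support.sup fun k ↦ (F.coeff k).natDegree + k) ≤ 2 * N := by
    refine Finset.sup_le fun k hk ↦ ?_
    have hk' : k ≤ F.natDegree := le_natDegree_of_mem_supp k hk
    have := hFc k
    omega
  have hsupu := (sup_support_le_of_dvd hu hF0).trans hsupF
  refine ⟨fun k j hjk ↦ ?_, (natDegree_le_of_dvd hu hF0).trans hFd, fun k ↦ ?_⟩
  · by_contra hne
    have hk : u.coeff k ≠ 0 := fun h0 ↦ hne (by rw [h0, coeff_zero])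
    have h1 := (le_sup_support hk).trans hsupu
    have h2 : j ≤ (u.coeff k).natDegree := le_natDegree_of_ne_zero hne
    omega
  · by_cases hk : u.coeff k = 0
    · rw [hk, natDegree_zero]; exact Nat.zero_le _
    · have := (le_sup_support hk).trans hsupu
      omega

/-- **Many rational points on a plane curve with a non-singular rational point, uniformly.**
For all `N, n` there is `q₀` such that for every finite field `K = 𝔽_q` with `q ≥ q₀` and all
`F, Q ∈ K[X][Y]` with `deg_Y ≤ N` and coefficients of `deg_X ≤ N`: if `F(a,b) = 0`,
`∂F/∂Y(a,b) ≠ 0` and `Q(a,b) ≠ 0` for some `(a,b) ∈ K²`, then at least `n` points `(a',b') ∈ K²`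
satisfy `F(a',b') = 0 ≠ Q(a',b')`.  Proof: the irreducible factor `u` of `F` through `(a, b)` is
simple there (product rule), hence absolutely irreducible (`irreducible_map_of_nonsingular`) and
prime to `Q`; Weil's lower bound `#{u = 0} ≥ q - (δ-1)(δ-2)√q - δ³`
(`abs_card_zeros_sub_le_of_irreducible_map`) minus the weak Bézout bound for `{u = 0 = Q}`
(`Dioph.commonZeros_finite_ncard_le`) exceeds `n` for `q` large.
[cite: Weil1948, §IV (number of points on a curve over a finite field)]
[cite: CafureMatera2006, Lemma 5.1] -/
theorem exists_le_ncard_zeros_of_nonsingular (N n : ℕ) : ∃ q₀ : ℕ,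
    ∀ (K : Type u) [Field K] [Fintype K], q₀ ≤ Fintype.card K → ∀ (F Q : K[X][Y]),
      F.natDegree ≤ N → (∀ k, (F.coeff k).natDegree ≤ N) →
      Q.natDegree ≤ N → (∀ k, (Q.coeff k).natDegree ≤ N) →
      ∀ a b : K, F.evalEval a b = 0 → (derivative F).evalEval a b ≠ 0 → Q.evalEval a b ≠ 0 →
        n ≤ {p : K × K | F.evalEval p.1 p.2 = 0 ∧ Q.evalEval p.1 p.2 ≠ 0}.ncard := by
  -- constants
  set δ : ℕ := 2 * N + 2 with hδ
  set B : ℕ := (2 * δ) ^ 4 with hB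
  set M : ℕ := n + δ ^ 3 + B with hM
  refine ⟨(δ ^ 2 + M) ^ 2, fun K _ _ hq F Q hFd hFc hQd hQc a b hFab hFd' hQab ↦ ?_⟩
  set q := Fintype.card K with hq'
  have hF0 : F ≠ 0 := by rintro rfl; simp at hFd'
  -- the irreducible factor through `(a, b)`
  obtain ⟨u, humem, huab⟩ := (evalEval_eq_zero_iff_exists_normalizedFactor hF0 a b).1 hFab
  have huirr : Irreducible u := UniqueFactorizationMonoid.irreducible_of_normalized_factor u humem
  have hudvd : u ∣ F := UniqueFactorizationMonoid.dvd_of_mem_normalizedFactors humem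
  obtain ⟨v, hv⟩ := hudvd
  have hud : (derivative u).evalEval a b ≠ 0 := by
    intro h0
    apply hFd'
    rw [hv, derivative_mul, evalEval_add, evalEval_mul, evalEval_mul, huab, h0, zero_mul,
      zero_mul, add_zero]
  have huQ : ¬ u ∣ Q := fun h ↦ hQab (by
    obtain ⟨w, rfl⟩ := h; rw [evalEval_mul, huab, zero_mul])
  -- absolute irreducibility and degrees
  have hirr := irreducible_map_of_nonsingular
    (algebraMap K (AlgebraicClosure K) : K →+* AlgebraicClosure K) huirr huab hud
  obtain ⟨huTD, hudeg, hucoef⟩ := degree_bounds_of_dvd hF0 ⟨v, hv⟩ hFd hFc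
  have hδ2 : 2 ≤ δ := by omega
  have huTD' : ∀ k j, δ < j + k → (u.coeff k).coeff j = 0 := fun k j h ↦ huTD k j (by omega)
  -- Weil lower bound for `u`
  have hW := abs_card_zeros_sub_le_of_irreducible_map hδ2 huTD'
    (algebraMap K (AlgebraicClosure K) : K →+* AlgebraicClosure K) hirr
  rw [abs_le] at hW
  -- Bézout upper bound for `{u = 0 = Q}`
  obtain ⟨hZfin, hZcard⟩ := Dioph.commonZeros_finite_ncard_le huirr huQ
    (hudeg.trans (by omega : N ≤ δ)) (fun i ↦ (hucoef i).trans (by omega))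
    (hQd.trans (by omega : N ≤ δ)) (fun i ↦ (hQc i).trans (by omega))
  have hB' : {p : K × K | u.evalEval p.1 p.2 = 0 ∧ Q.evalEval p.1 p.2 = 0}.ncard ≤ B := by
    rw [hB, show 2 * δ = δ + δ by ring]; exact hZcard
  -- the set to count contains `{u = 0} \ {u = 0 = Q}`
  set S := {p : K × K | F.evalEval p.1 p.2 = 0 ∧ Q.evalEval p.1 p.2 ≠ 0} with hS
  set U : Finset (K × K) := Finset.univ.filter fun p : K × K ↦ u.evalEval p.1 p.2 = 0 with hU
  set Z := {p : K × K | u.evalEval p.1 p.2 = 0 ∧ Q.evalEval p.1 p.2 = 0} with hZ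
  have hsub : (↑U : Set (K × K)) \ Z ⊆ S := by
    rintro ⟨x, y⟩ ⟨hxU, hxZ⟩
    simp only [hU, Finset.coe_filter, Finset.mem_univ, true_and, Set.mem_setOf_eq] at hxU
    simp only [hZ, Set.mem_setOf_eq, not_and] at hxZ
    refine ⟨by rw [hv, evalEval_mul, hxU, zero_mul], hxZ hxU⟩
  have hncard : U.card ≤ S.ncard + B := by
    have h1 : (↑U : Set (K × K)).ncard ≤ ((↑U : Set (K × K)) \ Z).ncard + Z.ncard :=
      Set.ncard_le_ncard_sdiff_add_ncard _ _ hZfin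
    have h2 : ((↑U : Set (K × K)) \ Z).ncard ≤ S.ncard := Set.ncard_le_ncard hsub (Set.toFinite S)
    rw [Set.ncard_coe_finset] at h1
    omega
  -- arithmetic: `U.card ≥ q - δ²√q - δ³ ≥ M` for `q ≥ (δ² + M)²`
  have h0 : 0 ≤ √(q : ℝ) := Real.sqrt_nonneg _
  have hsq : ((δ ^ 2 + M : ℕ) : ℝ) ≤ √(q : ℝ) := by
    have h := Real.sqrt_le_sqrt (x := (((δ ^ 2 + M) ^ 2 : ℕ) : ℝ)) (y := (q : ℝ))
      (by exact_mod_cast hq)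
    rwa [Nat.cast_pow, Real.sqrt_sq (Nat.cast_nonneg _)] at h
  push_cast at hsq
  have hδr : (2 : ℝ) ≤ δ := by exact_mod_cast hδ2
  have hMr : (0 : ℝ) ≤ M := Nat.cast_nonneg _
  have hq1 : (1 : ℝ) ≤ √(q : ℝ) := by nlinarith
  have hqq : (q : ℝ) = √(q : ℝ) * √(q : ℝ) := (Real.mul_self_sqrt (Nat.cast_nonneg _)).symm
  have hdd : (((δ - 1) * (δ - 2) : ℕ) : ℝ) ≤ (δ : ℝ) ^ 2 := by
    have : (δ - 1) * (δ - 2) ≤ δ ^ 2 := by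
      calc (δ - 1) * (δ - 2) ≤ δ * δ := Nat.mul_le_mul (Nat.sub_le _ _) (Nat.sub_le _ _)
        _ = δ ^ 2 := (sq δ).symm
    exact_mod_cast this
  have e1 : 0 ≤ (√(q : ℝ) - δ ^ 2 - M) * √(q : ℝ) := mul_nonneg (by linarith) h0
  have e2 : 0 ≤ (M : ℝ) * (√(q : ℝ) - 1) := mul_nonneg hMr (by linarith)
  have e3 : 0 ≤ ((δ : ℝ) ^ 2 - (((δ - 1) * (δ - 2) : ℕ) : ℝ)) * √(q : ℝ) :=
    mul_nonneg (by linarith) h0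
  have hfinal : (n : ℝ) ≤ S.ncard := by
    have h1 : ((U.card : ℕ) : ℝ) ≤ (S.ncard : ℝ) + B := by exact_mod_cast hncard
    have h2 : (M : ℝ) = n + (δ : ℝ) ^ 3 + B := by rw [hM]; push_cast; ring
    nlinarith [hW.1, e1, e2, e3, hqq]
  exact_mod_cast hfinal

end Count

end Literature.NumberTheory.DiophantineGeometry.PlaneShear
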